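import Summits.QuantumFields.GaugeBoot.TiltedBoxRedLinkTubeReflect
import HarnessLib

/-!
# The reduced half of the link mirror of the odd square tilted box: the value of the tube term (gauge-boot, L3 supplement: reduced-half in-plane mirrors, 6d/7)

HONEST FRAMING (cell `pub-gaugeboot`, page 1 of every file): the venture produces certified bounds
on lattice expectations at stated coupling, gauge group, dimension and torus size; NOT a mass gap,
NOT a continuum limit, NOT a string tension; NOT Yang–Mills-summit-bearing (barriers
`FixedCouplingUltralocality`, `PerturbativeInvisibility`). This module is bookkeeping for a small
structural NEGATIVE result (the REDUCED-half in-plane mirrors of the square tilted boxes are not of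
positive type in `d ≥ 3` at small coupling); it discharges nothing by itself.

## Content (odd box, `P ≥ 2`, `L ≥ 2`, compact metrisable `G`, continuous `ρ` with (R1), constant `c₁`)

For the near pair `v = (z; q)` (layer `P`, `q₁, q₂ ≠ i`) and `u = v + 2e_i`:

* `integral_plaqObs_sq` — `∫ W_p² ∏ dU = c₁ N` for a transverse plaquette `p`;
* ★★ **`leadM_tube_eq`** — THE LEADING MOMENT OF THE TUBE TERM:
  `∫ W_u W_v ∏_{q ∈ tube} W_q ∏ dU = c₁⁹ N`
  (lower cup `c₁⁴ ×` ring, mirror, second cup `c₁⁴ ×` ring, `∫ W_{ring}² = c₁ N`);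
* ★ **`pairT_tube_ge`** — hence, by `PairExp.abs_pairT_sub_leading_le`,
  `T_{tube}(u, v) ≥ β⁸ c₁⁹ N - N² 2⁸ (βN)⁹` for `0 ≤ β`, `βN ≤ 1`.

With `c₁ > 0` (true for `SU(N)`, `U(N)`) the near pair terms are positive at leading order `β⁸`; they
enter the trick sum with a minus sign. Elementary.
-/

noncomputable section

open QuotientAddGroup Finset Function MeasureTheory
open Literature.MathematicalPhysics.QuantumFieldTheory (haarProbability)
open Literature.MathematicalPhysics.QuantumFieldTheory.PlaquetteLowerBound (reTr)
open Literature.RepresentationTheory.CompactGroups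

namespace Summit.QuantumFields.GaugeBoot

namespace TiltedRP

namespace RedLink

variable {d : ℕ} {i j : Fin d} {L P N : ℕ} [NeZero L] [NeZero P]
  [DecidableEq (TiltedSite d i j (2 * P + 1) (2 * P + 1) L)]
variable {G : Type*} [Group G] [TopologicalSpace G] [IsTopologicalGroup G] [CompactSpace G]
  [MeasurableSpace G] [BorelSpace G] [SecondCountableTopology G]
variable (ρ : G →* Matrix (Fin N) (Fin N) ℂ) (q : DirPair d) {c₁ : ℝ}
  (hR1 : ∀ x y : G, ∫ g, reTr ρ (x * g⁻¹) * reTr ρ (g * y) ∂haarProbability G = c₁ * reTr ρ (x * y))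

/-! ## `∫ W_p² = c₁ N` -/

omit [NeZero P] in
include hR1 in
/-- **`∫ Re tr ρ(U_p)² ∏ dU = c₁ N`** for a transverse plaquette `p = (x; q)` (`P ≥ 2`, `L ≥ 2`, so that
its four links are distinct). [folklore] -/
theorem integral_plaqObs_sq (hP : 2 ≤ P) (hij : i ≠ j) (hL : 2 ≤ L) (hρ : Continuous ρ)
    (x : TiltedSite d i j (2 * P + 1) (2 * P + 1) L) :
    ∫ U, plaqObs ρ (tiltedUnit d i j (2 * P + 1) (2 * P + 1) L) (x, q) U * plaqObs ρ (tiltedUnit d i j (2 * P + 1) (2 * P + 1) L) (x, q) U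
        ∂(productHaar (TiltedSite d i j (2 * P + 1) (2 * P + 1) L) d G) = c₁ * N := by
  have hq12 : q.1.1 ≠ q.1.2 := ne_of_lt q.2
  have he := tiltedUnit_ne_zero_all (d := d) hP hij hL
  haveI := isProbabilityMeasure_productHaar (A := TiltedSite d i j (2 * P + 1) (2 * P + 1) L) (d := d) (G := G)
  haveI : IsProbabilityMeasure (haarProbability G) := CompactGroup.isProbabilityMeasure_haarMeasure_top
  have n1 : ((x + tiltedUnit d i j (2 * P + 1) (2 * P + 1) L q.1.1, q.1.2) : Link _ d) ≠ (x, q.1.1) := fun h => hq12 (Prod.mk.inj h).2.symm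
  have n2 : ((x + tiltedUnit d i j (2 * P + 1) (2 * P + 1) L q.1.2, q.1.1) : Link _ d) ≠ (x, q.1.1) := fun h =>
    he _ (by simpa using (Prod.mk.inj h).1)
  have n3 : ((x, q.1.2) : Link _ d) ≠ (x, q.1.1) := fun h => hq12 (Prod.mk.inj h).2.symm
  unfold productHaar
  refine Eq.trans (DiagRPSUN.integral_pi_update_of_forall (haarProbability G) ((x, q.1.1) : Link _ d)
    (H := fun _ => c₁ * N) (TwistedSlab.integrable_config_of_continuous
      ((continuous_plaqObs ρ hρ _ _).mul (continuous_plaqObs ρ hρ _ _))) fun U => ?_) (by simp)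
  simp_rw [plaqObs_transverse_eq, update_self, update_of_ne n1, update_of_ne n2, update_of_ne n3]
  set y := U (x + tiltedUnit d i j (2 * P + 1) (2 * P + 1) L q.1.1, q.1.2) *
    (U (x + tiltedUnit d i j (2 * P + 1) (2 * P + 1) L q.1.2, q.1.1))⁻¹ * (U (x, q.1.2))⁻¹ with hy
  have h1 : ∀ s : G, s * U (x + tiltedUnit d i j (2 * P + 1) (2 * P + 1) L q.1.1, q.1.2) *
      (U (x + tiltedUnit d i j (2 * P + 1) (2 * P + 1) L q.1.2, q.1.1))⁻¹ * (U (x, q.1.2))⁻¹ = s * y := fun s => by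
    rw [hy]; group
  simp_rw [h1]
  have h2 : ∀ s : G, reTr ρ (s * y) * reTr ρ (s * y) = reTr ρ (y⁻¹ * s⁻¹) * reTr ρ (s * y) := fun s => by
    rw [show y⁻¹ * s⁻¹ = (s * y)⁻¹ by group]
    congr 1
    exact (CompactGroup.re_trace_map_inv ρ hρ _).symm
  simp_rw [h2]
  rw [hR1, inv_mul_cancel]
  congr 1
  show ((ρ 1).trace).re = N
  rw [map_one, Matrix.trace_one, Fintype.card_fin]; simp

/-! ## The leading moment of the tube term -/

include hR1 in
/-- ★★ **THE LEADING MOMENT OF THE TUBE TERM**: for `v = (z; q)` in the layer `P` and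
`u = v + 2e_i`, `∫ W_u W_v ∏_{q ∈ tube} W_q ∏ dU = c₁⁹ N`. [folklore] -/
theorem leadM_tube_eq (hP : 2 ≤ P) (hij : i ≠ j) (hL : 2 ≤ L) (hq1 : q.1.1 ≠ i) (hq2 : q.1.2 ≠ i) (hρ : Continuous ρ)
    {z : TiltedSite d i j (2 * P + 1) (2 * P + 1) L} (hz : (axisCoord d L (2 * P + 1) z).val = P) :
    PairExp.leadM ρ (tiltedUnit d i j (2 * P + 1) (2 * P + 1) L)
        (tube q (z + tiltedUnit d i j (2 * P + 1) (2 * P + 1) L i + tiltedUnit d i j (2 * P + 1) (2 * P + 1) L i, q) (z, q))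
        (z + tiltedUnit d i j (2 * P + 1) (2 * P + 1) L i + tiltedUnit d i j (2 * P + 1) (2 * P + 1) L i, q) (z, q) = c₁ ^ 9 * N := by
  have hzi : (axisCoord d L (2 * P + 1) (z + tiltedUnit d i j (2 * P + 1) (2 * P + 1) L i)).val = P + 1 := val_axisCoord_up hP hz
  have hw : (axisCoord d L (2 * P + 1) (z + tiltedUnit d i j (2 * P + 1) (2 * P + 1) L i + tiltedUnit d i j (2 * P + 1) (2 * P + 1) L i)).val = P + 2 := by
    rw [val_axisCoord_add_self _ (by rw [hzi]; omega), hzi]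
  have hzT : (axisCoord d L (2 * P + 1) (z + tiltedTwist d L (2 * P + 1))).val = P := by
    rw [map_add, axisCoord_tiltedTwist d L _ hij, add_zero, hz]
  have hzTi : (axisCoord d L (2 * P + 1) (z + tiltedTwist d L (2 * P + 1) + tiltedUnit d i j (2 * P + 1) (2 * P + 1) L i)).val = P + 1 :=
    val_axisCoord_up hP hzT
  have hcW : ∀ p : Plaq (TiltedSite d i j (2 * P + 1) (2 * P + 1) L) d,
      Continuous (plaqObs (G := G) ρ (tiltedUnit d i j (2 * P + 1) (2 * P + 1) L) p) := fun p => continuous_plaqObs ρ hρ _ p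
  -- `u` and the hanging plaquettes do not read the links of `v`
  have hu : ∀ a : Fin 4, ¬ PairExp.HasLink (tiltedUnit d i j (2 * P + 1) (2 * P + 1) L)
      (z + tiltedUnit d i j (2 * P + 1) (2 * P + 1) L i + tiltedUnit d i j (2 * P + 1) (2 * P + 1) L i, q)
      (PairExp.plink (tiltedUnit d i j (2 * P + 1) (2 * P + 1) L) ((z, q) : Plaq _ d) a) := fun a =>
    not_hasLink_of_val_ne q hq1 hq2 (by rw [hz, hw]; omega) ⟨a, rfl⟩
  unfold PairExp.leadM
  simp_rw [prod_tube_eq q hP hij hL hq1 hq2 hz hw]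
  -- Step 1: the lower cup, against `R = W_u ∏ W_H`
  have h1 : ∀ U : Config (TiltedSite d i j (2 * P + 1) (2 * P + 1) L) d G,
      plaqObs ρ (tiltedUnit d i j (2 * P + 1) (2 * P + 1) L) (z + tiltedUnit d i j (2 * P + 1) (2 * P + 1) L i + tiltedUnit d i j (2 * P + 1) (2 * P + 1) L i, q) U *
        plaqObs ρ (tiltedUnit d i j (2 * P + 1) (2 * P + 1) L) (z, q) U *
        ((∏ a : Fin 4, plaqObs ρ (tiltedUnit d i j (2 * P + 1) (2 * P + 1) L)
            (stand q (PairExp.plink (tiltedUnit d i j (2 * P + 1) (2 * P + 1) L) ((z, q) : Plaq _ d) a)) U) *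
          ∏ a : Fin 4, plaqObs ρ (tiltedUnit d i j (2 * P + 1) (2 * P + 1) L)
            (hang q (PairExp.plink (tiltedUnit d i j (2 * P + 1) (2 * P + 1) L)
              ((z + tiltedUnit d i j (2 * P + 1) (2 * P + 1) L i + tiltedUnit d i j (2 * P + 1) (2 * P + 1) L i, q) : Plaq _ d) a)) U) =
      plaqObs ρ (tiltedUnit d i j (2 * P + 1) (2 * P + 1) L) (z, q) U *
        (plaqObs ρ (tiltedUnit d i j (2 * P + 1) (2 * P + 1) L) (stand q (z, q.1.1)) U *
          plaqObs ρ (tiltedUnit d i j (2 * P + 1) (2 * P + 1) L) (stand q (z + tiltedUnit d i j (2 * P + 1) (2 * P + 1) L q.1.1, q.1.2)) U *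
          plaqObs ρ (tiltedUnit d i j (2 * P + 1) (2 * P + 1) L) (stand q (z + tiltedUnit d i j (2 * P + 1) (2 * P + 1) L q.1.2, q.1.1)) U *
          plaqObs ρ (tiltedUnit d i j (2 * P + 1) (2 * P + 1) L) (stand q (z, q.1.2)) U) *
        (plaqObs ρ (tiltedUnit d i j (2 * P + 1) (2 * P + 1) L) (z + tiltedUnit d i j (2 * P + 1) (2 * P + 1) L i + tiltedUnit d i j (2 * P + 1) (2 * P + 1) L i, q) U *
          ∏ a : Fin 4, plaqObs ρ (tiltedUnit d i j (2 * P + 1) (2 * P + 1) L)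
            (hang q (PairExp.plink (tiltedUnit d i j (2 * P + 1) (2 * P + 1) L)
              ((z + tiltedUnit d i j (2 * P + 1) (2 * P + 1) L i + tiltedUnit d i j (2 * P + 1) (2 * P + 1) L i, q) : Plaq _ d) a)) U) := by
    intro U
    rw [Fin.prod_univ_four]
    simp only [PairExp.plink]
    ring
  simp_rw [h1]
  rw [integral_cup_eq ρ q z hR1 hP hij hL hq1 hq2 hρ
    (R := fun U => plaqObs ρ (tiltedUnit d i j (2 * P + 1) (2 * P + 1) L) (z + tiltedUnit d i j (2 * P + 1) (2 * P + 1) L i + tiltedUnit d i j (2 * P + 1) (2 * P + 1) L i, q) U *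
      ∏ a : Fin 4, plaqObs ρ (tiltedUnit d i j (2 * P + 1) (2 * P + 1) L)
        (hang q (PairExp.plink (tiltedUnit d i j (2 * P + 1) (2 * P + 1) L) ((z + tiltedUnit d i j (2 * P + 1) (2 * P + 1) L i + tiltedUnit d i j (2 * P + 1) (2 * P + 1) L i, q) : Plaq _ d) a)) U)
    (((hcW _).mul (continuous_finsetProd _ fun a _ => hcW _)))
    (fun U a s => by
      show _ = plaqObs ρ (tiltedUnit d i j (2 * P + 1) (2 * P + 1) L) (z + tiltedUnit d i j (2 * P + 1) (2 * P + 1) L i + tiltedUnit d i j (2 * P + 1) (2 * P + 1) L i, q) U *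
        ∏ a : Fin 4, plaqObs ρ (tiltedUnit d i j (2 * P + 1) (2 * P + 1) L)
          (hang q (PairExp.plink (tiltedUnit d i j (2 * P + 1) (2 * P + 1) L) ((z + tiltedUnit d i j (2 * P + 1) (2 * P + 1) L i + tiltedUnit d i j (2 * P + 1) (2 * P + 1) L i, q) : Plaq _ d) a)) U
      rw [PairExp.plaqObs_update_of_not_hasLink _ ρ _ (hu a)]
      congr 1
      exact Finset.prod_congr rfl fun b _ =>
        PairExp.plaqObs_update_of_not_hasLink _ ρ _ (not_hasLink_hang_lower q hP hq1 hq2 hz hw b a) U s)]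
  -- Step 2: the mirror turns the upper cup into a lower cup of `v + T`
  rw [integral_ring_upper_eq ρ q hij hq1 hq2 hρ hz]
  -- Step 3: the second cup, against `R = W_{v + T + e_i}`
  have h2 : ∀ U : Config (TiltedSite d i j (2 * P + 1) (2 * P + 1) L) d G,
      plaqObs ρ (tiltedUnit d i j (2 * P + 1) (2 * P + 1) L) (z + tiltedTwist d L (2 * P + 1), q) U *
        (∏ a : Fin 4, plaqObs ρ (tiltedUnit d i j (2 * P + 1) (2 * P + 1) L)
            (stand q (PairExp.plink (tiltedUnit d i j (2 * P + 1) (2 * P + 1) L) ((z + tiltedTwist d L (2 * P + 1), q) : Plaq _ d) a)) U) *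
        plaqObs ρ (tiltedUnit d i j (2 * P + 1) (2 * P + 1) L) (z + tiltedTwist d L (2 * P + 1) + tiltedUnit d i j (2 * P + 1) (2 * P + 1) L i, q) U =
      plaqObs ρ (tiltedUnit d i j (2 * P + 1) (2 * P + 1) L) (z + tiltedTwist d L (2 * P + 1), q) U *
        (plaqObs ρ (tiltedUnit d i j (2 * P + 1) (2 * P + 1) L) (stand q (z + tiltedTwist d L (2 * P + 1), q.1.1)) U *
          plaqObs ρ (tiltedUnit d i j (2 * P + 1) (2 * P + 1) L)
            (stand q (z + tiltedTwist d L (2 * P + 1) + tiltedUnit d i j (2 * P + 1) (2 * P + 1) L q.1.1, q.1.2)) U *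
          plaqObs ρ (tiltedUnit d i j (2 * P + 1) (2 * P + 1) L)
            (stand q (z + tiltedTwist d L (2 * P + 1) + tiltedUnit d i j (2 * P + 1) (2 * P + 1) L q.1.2, q.1.1)) U *
          plaqObs ρ (tiltedUnit d i j (2 * P + 1) (2 * P + 1) L) (stand q (z + tiltedTwist d L (2 * P + 1), q.1.2)) U) *
        plaqObs ρ (tiltedUnit d i j (2 * P + 1) (2 * P + 1) L) (z + tiltedTwist d L (2 * P + 1) + tiltedUnit d i j (2 * P + 1) (2 * P + 1) L i, q) U := by
    intro U
    rw [Fin.prod_univ_four]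
    simp only [PairExp.plink]
  simp_rw [h2]
  rw [integral_cup_eq ρ q (z + tiltedTwist d L (2 * P + 1)) hR1 hP hij hL hq1 hq2 hρ (hcW _)
    (fun U a s => PairExp.plaqObs_update_of_not_hasLink _ ρ _
      (not_hasLink_transverse_of_axisCoord_ne q hq1 hq2 (by rw [ne_eq, ← ZMod.val_injective _ |>.eq_iff, hzT, hzTi]; omega)
        ⟨a, rfl⟩) U s)]
  -- Step 4: `∫ W_ring² = c₁ N`
  rw [integral_plaqObs_sq ρ q hR1 hP hij hL hρ]
  ring

include hR1 in
/-- ★ **THE TUBE TERM TO LEADING ORDER**: for `0 ≤ β`, `βN ≤ 1`,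
`T_{tube}(u, v) ≥ β⁸ c₁⁹ N - N² 2⁸ (βN)⁹`. [folklore] -/
theorem pairT_tube_ge (hP : 2 ≤ P) (hij : i ≠ j) (hL : 2 ≤ L) (hq1 : q.1.1 ≠ i) (hq2 : q.1.2 ≠ i) (hρ : Continuous ρ)
    {β : ℝ} (hβ : 0 ≤ β) (hβN : β * N ≤ 1)
    {z : TiltedSite d i j (2 * P + 1) (2 * P + 1) L} (hz : (axisCoord d L (2 * P + 1) z).val = P) :
    β ^ 8 * (c₁ ^ 9 * N) - N ^ 2 * (2 ^ 8 * (β * N) ^ 9) ≤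
      PairExp.pairT ρ (tiltedUnit d i j (2 * P + 1) (2 * P + 1) L) β
        (tube q (z + tiltedUnit d i j (2 * P + 1) (2 * P + 1) L i + tiltedUnit d i j (2 * P + 1) (2 * P + 1) L i, q) (z, q))
        (z + tiltedUnit d i j (2 * P + 1) (2 * P + 1) L i + tiltedUnit d i j (2 * P + 1) (2 * P + 1) L i, q) (z, q) := by
  have hzi : (axisCoord d L (2 * P + 1) (z + tiltedUnit d i j (2 * P + 1) (2 * P + 1) L i)).val = P + 1 := val_axisCoord_up hP hz
  have hw : (axisCoord d L (2 * P + 1) (z + tiltedUnit d i j (2 * P + 1) (2 * P + 1) L i + tiltedUnit d i j (2 * P + 1) (2 * P + 1) L i)).val = P + 2 := by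
    rw [val_axisCoord_add_self _ (by rw [hzi]; omega), hzi]
  have hcard := card_tube q hP hij hL hq1 hq2 hz hw
  have h := PairExp.abs_pairT_sub_leading_le ρ (tiltedUnit d i j (2 * P + 1) (2 * P + 1) L) β hρ hβ hβN
    (tube q (z + tiltedUnit d i j (2 * P + 1) (2 * P + 1) L i + tiltedUnit d i j (2 * P + 1) (2 * P + 1) L i, q) (z, q))
    (z + tiltedUnit d i j (2 * P + 1) (2 * P + 1) L i + tiltedUnit d i j (2 * P + 1) (2 * P + 1) L i, q) (z, q)
  rw [hcard, leadM_tube_eq ρ q hR1 hP hij hL hq1 hq2 hρ hz, abs_le, show (8 + 1 : ℕ) = 9 from rfl] at h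
  linarith [h.1]

end RedLink

end TiltedRP

end Summit.QuantumFields.GaugeBoot

end
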